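import Literature.MathematicalPhysics.QuantumLattice.LiebRobinsonFnwGapPairProofs
import Literature.MathematicalPhysics.QuantumLattice.SpinChainsAkltGapProofs
import Literature.MathematicalPhysics.QuantumLattice.LocalOpTransport
import HarnessLib

/-!
# Coarse-grained projections on a ring: transport of the chain estimates

Sibling proof file of `Literature/MathematicalPhysics/QuantumLattice/LiebRobinson.lean`
(theorem-only: no definition, no named fact), a step towards the discharge of
`fannes_nachtergaele_werner_gap` (**hubbard.S16**; Fannes–Nachtergaele–Werner 1992, Thm. 6.4),
continuing `LiebRobinsonFnwGapPairProofs.lean`. FNW prove Thm. 6.4 on the open chain; here the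
chain-level objects (the `n`-site parent projections `h_n = 𝟙 - G_n`, the open-chain parent
Hamiltonians, the cross-term estimate `posSemidef_pair_chain`) are placed on blocks of a ring
`ℤ/L` through `onRingBlock`/`localOp`:

* `localOp_ringBlock_onRingBlock_localOp_chainBlock` — nested blocks: a chain sub-block operator
  placed on a ring block is the operator placed on the ring sub-block;
* `localOp_ringBlock_onRingBlock_parentHamiltonianOpen` — `(H^{open}_{N})_{x,…} = Σ_j h_{x+j,…}`;
* `posSemidef_parentLocalTerm_sub_localOp_chainBlock`, `posSemidef_bigBlock_sub_subBlock` —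
  `h_{x+j,…,x+j+n-1} ≤ (h_N)_{x,…,x+N-1}` (FNW Lemma 5.5, trivial inclusion `𝒢_N ⊆ ker h_{j}`);
* `isHermitian_bigBlock`, `bigBlock_mul_self`, `posSemidef_bigBlock`, `bigBlock_commute` — the
  coarse-grained projections `E = (h_N)_{x,…}` are commuting-when-disjoint orthogonal projections;
* `posSemidef_pair_ring` — the cross term of two neighbouring coarse-grained projections on the
  ring, `E₁ E₂ + E₂ E₁ + ε' (E₁ + E₂) ≥ 0` (transport of `posSemidef_pair_chain`).

## Source

* M. Fannes, B. Nachtergaele, R. F. Werner, *Finitely correlated states on quantum spin chains*,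
  Comm. Math. Phys. **144** (1992) 443–490, §5 Lemma 5.5, §6 Thm. 6.4 and its proof (p. 479).
  [FannesNachtergaeleWernerCMP1992]
-/

noncomputable section

open Matrix
open scoped ComplexOrder MatrixOrder

namespace Literature.MathematicalPhysics.QuantumLattice

section QLattice

variable {q D : ℕ}

/-! ### Nested blocks: a chain block placed inside a ring block -/

/-- **Nested block transport.** Placing an `n`-site operator on the sub-block `{j, …, j+n-1}` of the
open chain `Fin N` and then placing the chain on the ring block `{x, …, x+N-1}` (`N ≤ L`) is placing
the operator directly on the ring block `{x+j, …, x+j+n-1}`. [folklore] -/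
theorem localOp_ringBlock_onRingBlock_localOp_chainBlock (L : ℕ) [NeZero L] {N n : ℕ}
    (hN : N ≤ L) (x : ZMod L) (j : Fin N) (hj : (j : ℕ) + n ≤ N) (M : Op (Fin n) q) :
    localOp (ringBlock L N x) (onRingBlock L N x (localOp (chainBlock N n j hj)
        (M.submatrix (fun σ i => σ (chainBlockSite N n j hj i))
          (fun σ i => σ (chainBlockSite N n j hj i))))) =
      localOp (ringBlock L n (x + ((j : ℕ) : ZMod L)))
        (onRingBlock L n (x + ((j : ℕ) : ZMod L)) M) := by
  ext σ τ
  simp only [localOp_apply, onRingBlock, submatrix_apply]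
  -- the arguments of `M` agree
  have hargs : ∀ ρ : TensorIndex (ZMod L) q,
      (fun i : Fin n => (fun z : Fin N => ρ (ringBlockSite L N x z : ZMod L))
        (chainBlockSite N n j hj i)) =
        fun i : Fin n => ρ (ringBlockSite L n (x + ((j : ℕ) : ZMod L)) i : ZMod L) := by
    intro ρ
    funext i
    simp only [coe_chainBlockSite]
    show ρ (x + (((j : ℕ) + (i : ℕ) : ℕ) : ZMod L)) = ρ (x + ((j : ℕ) : ZMod L) + ((i : ℕ) : ZMod L))
    rw [Nat.cast_add, add_assoc]
  -- the agreement conditions are equivalent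
  have hsmall_sub_big : ∀ y : ZMod L, y ∈ ringBlock L n (x + ((j : ℕ) : ZMod L)) →
      y ∈ ringBlock L N x := by
    intro y hy
    obtain ⟨i, rfl⟩ := (mem_ringBlock_iff _ _).1 hy
    exact (mem_ringBlock_iff _ _).2 ⟨⟨j + i, by omega⟩, by push_cast; ring⟩
  have hcond : ((∀ y, y ∉ ringBlock L N x → σ y = τ y) ∧
      (∀ z : Fin N, z ∉ chainBlock N n j hj →
        σ (ringBlockSite L N x z : ZMod L) = τ (ringBlockSite L N x z : ZMod L))) ↔
      (∀ y, y ∉ ringBlock L n (x + ((j : ℕ) : ZMod L)) → σ y = τ y) := by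
    constructor
    · rintro ⟨hbig, hin⟩ y hy
      by_cases hyb : y ∈ ringBlock L N x
      · obtain ⟨z, rfl⟩ := (mem_ringBlock_iff _ _).1 hyb
        refine hin z fun hz => hy ?_
        obtain ⟨i, hi⟩ : ∃ i : Fin n, (⟨j + i, by omega⟩ : Fin N) = z := by
          simpa [chainBlock] using hz
        rw [← hi]
        exact (mem_ringBlock_iff _ _).2 ⟨i, by push_cast; ring⟩
      · exact hbig y hyb
    · intro hsmall
      refine ⟨fun y hy => hsmall y fun h => hy (hsmall_sub_big y h), fun z hz => hsmall _ fun h => hz ?_⟩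
      obtain ⟨i, hi⟩ := (mem_ringBlock_iff _ _).1 h
      have hzi : (z : ℕ) = (j : ℕ) + (i : ℕ) := by
        have h' : ((z : ℕ) : ZMod L) = (((j : ℕ) + (i : ℕ) : ℕ) : ZMod L) := by
          have hi' : x + ((z : ℕ) : ZMod L) = x + ((j : ℕ) : ZMod L) + ((i : ℕ) : ZMod L) := hi
          rw [add_left_cancel (hi'.trans (add_assoc _ _ _)), Nat.cast_add]
        by_contra hne
        exact natCast_ne_natCast_zmod (lt_of_lt_of_le z.2 hN) (by omega) hne h'
      simp only [chainBlock, Finset.mem_image, Finset.mem_univ, true_and]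
      exact ⟨i, Fin.ext (by simp [hzi])⟩
  by_cases hs : ∀ y, y ∉ ringBlock L n (x + ((j : ℕ) : ZMod L)) → σ y = τ y
  · obtain ⟨hbig, hin⟩ := hcond.2 hs
    rw [if_pos hbig, if_pos hin, if_pos hs, hargs σ, hargs τ]
  · rw [if_neg hs]
    by_cases hbig : ∀ y, y ∉ ringBlock L N x → σ y = τ y
    · rw [if_pos hbig, if_neg]
      exact fun hin => hs (hcond.1 ⟨hbig, hin⟩)
    · rw [if_neg hbig]

/-- **The open-chain parent Hamiltonian placed on a ring block** is the sum of the ring block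
terms of its sub-blocks: `(H_{[1,N]})_{x,…,x+N-1} = Σ_{j+n ≤ N} h_{x+j,…,x+j+n-1}` (`N ≤ L`).
[folklore] -/
theorem localOp_ringBlock_onRingBlock_parentHamiltonianOpen (L : ℕ) [NeZero L] {N : ℕ}
    (hN : N ≤ L) (x : ZMod L) (n : ℕ) (A : MPSTensor q D) :
    localOp (ringBlock L N x) (onRingBlock L N x (parentHamiltonianOpen N n A)) =
      ∑ j : Fin N, if (j : ℕ) + n ≤ N then
        localOp (ringBlock L n (x + ((j : ℕ) : ZMod L)))
          (onRingBlock L n (x + ((j : ℕ) : ZMod L)) (parentLocalTerm n A)) else 0 := by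
  unfold parentHamiltonianOpen onRingBlock
  rw [localOp_submatrix_sum]
  refine Finset.sum_congr rfl fun j _ => ?_
  split_ifs with h
  · exact localOp_ringBlock_onRingBlock_localOp_chainBlock L hN x j h (parentLocalTerm n A)
  · simp

/-! ### Sub-block terms are dominated by the big-block projection -/

/-- On the open chain, a block term `h_{j,…,j+n-1} ⊗ 𝟙` of any length is *dominated by* the
whole-chain projection `h_N = 1 - P_{𝒢_N}`: `h_{j,…} ≤ h_N`. Indeed `h_{j,…}` kills `𝒢_N = ran (1 - h_N)`
(the block slices of a `ψ_X` are boundary MPS, FNW Lemma 5.5 trivial inclusion), so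
`h_{j,…} = h_{j,…} h_N = h_N h_{j,…}` and `h_N - h_{j,…} = h_N (1 - h_{j,…}) h_N ≥ 0`.
[cite: FannesNachtergaeleWernerCMP1992, §5 Lemma 5.5] -/
theorem posSemidef_parentLocalTerm_sub_localOp_chainBlock {N n : ℕ} (j : Fin N)
    (hj : (j : ℕ) + n ≤ N) (A : MPSTensor q D) :
    (parentLocalTerm N A - localOp (chainBlock N n j hj)
        ((parentLocalTerm n A).submatrix (fun σ i => σ (chainBlockSite N n j hj i))
          (fun σ i => σ (chainBlockSite N n j hj i)))).PosSemidef := by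
  set P : Op (Fin N) q := parentLocalTerm N A with hPdef
  set hsub : Op (Fin N) q := localOp (chainBlock N n j hj)
    ((parentLocalTerm n A).submatrix (fun σ i => σ (chainBlockSite N n j hj i))
      (fun σ i => σ (chainBlockSite N n j hj i))) with hsubdef
  have hPh : P.IsHermitian := projMatrix_isHermitian _
  have hPP : P * P = P := projMatrix_mul_self _
  have hsh : hsub.IsHermitian := isHermitian_localOp _ ((projMatrix_isHermitian _).submatrix _)
  have hss : hsub * hsub = hsub := by
    rw [hsubdef, ← localOp_submatrix_mul _ (chainBlockSite_bijective _ _ j hj), parentLocalTerm,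
      projMatrix_mul_self]
  -- `hsub (1 - P) = 0`
  have hvan : hsub * (1 - P) = 0 := by
    refine eq_zero_of_forall_mulVec_eq_zero fun v => ?_
    have hP1 : (1 - P) *ᵥ v = ((mpsRange N A).starProjection (WithLp.toLp 2 v)).ofLp := by
      have h := projMatrix_mulVec (mpsRange N A)ᗮ (WithLp.toLp 2 v)
      rw [Submodule.starProjection_orthogonal_val] at h
      rw [sub_mulVec, one_mulVec, hPdef, parentLocalTerm, h]
      simp
    obtain ⟨X, hX⟩ := exists_mpsWithBoundary_of_mem_mpsRange N A
      (Submodule.starProjection_apply_mem (mpsRange N A) (WithLp.toLp 2 v))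
    rw [← mulVec_mulVec, hP1, ← hX]
    exact localOp_chainBlock_parentLocalTerm_mulVec_mpsWithBoundary j hj A X
  have h1 : hsub * P = hsub := by
    have := hvan
    rw [Matrix.mul_sub, Matrix.mul_one, sub_eq_zero] at this
    exact this.symm
  have h2 : P * hsub = hsub := by
    have := congrArg conjTranspose h1
    rwa [conjTranspose_mul, hPh.eq, hsh.eq] at this
  have e : P - hsub = Pᴴ * (1 - hsub) * P := by
    rw [hPh.eq, Matrix.mul_sub, Matrix.mul_one, Matrix.sub_mul, hPP, Matrix.mul_assoc, h1, h2]
  rw [e]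
  exact (posSemidef_of_isHermitian_of_mul_self (isHermitian_one.sub hsh)
    (by simp [Matrix.sub_mul, Matrix.mul_sub, hss])).conjTranspose_mul_mul_same P

/-- **On the ring, each `ℓ`-block term inside a big block is dominated by the big-block projection**:
for `N ≤ L` and `j + n ≤ N`, `h_{x+j,…,x+j+n-1} ≤ (h_N)_{x,…,x+N-1}` (transport of
`posSemidef_parentLocalTerm_sub_localOp_chainBlock` by the positive map `M ↦ M ⊗ 𝟙`).
[cite: FannesNachtergaeleWernerCMP1992, §5 Lemma 5.5] -/
theorem posSemidef_bigBlock_sub_subBlock (L : ℕ) [NeZero L] {N n : ℕ} (hN : N ≤ L) (x : ZMod L)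
    (j : Fin N) (hj : (j : ℕ) + n ≤ N) (A : MPSTensor q D) :
    (localOp (ringBlock L N x) (onRingBlock L N x (parentLocalTerm N A)) -
      localOp (ringBlock L n (x + ((j : ℕ) : ZMod L)))
        (onRingBlock L n (x + ((j : ℕ) : ZMod L)) (parentLocalTerm n A))).PosSemidef := by
  have h := posSemidef_localOp (ringBlock L N x) (posSemidef_onRingBlock L N x
    (posSemidef_parentLocalTerm_sub_localOp_chainBlock j hj A))
  rw [onRingBlock, localOp_submatrix_sub] at h
  rw [← localOp_ringBlock_onRingBlock_localOp_chainBlock L hN x j hj]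
  exact h

/-! ### Big-block projections: algebra -/

/-- The big-block operator `(h_N)_{x,…,x+N-1}` is Hermitian. [folklore] -/
theorem isHermitian_bigBlock (L : ℕ) [NeZero L] (N : ℕ) (x : ZMod L) (A : MPSTensor q D) :
    (localOp (ringBlock L N x) (onRingBlock L N x (parentLocalTerm N A))).IsHermitian :=
  isHermitian_localOp _ ((projMatrix_isHermitian _).submatrix _)

/-- The big-block operator `(h_N)_{x,…,x+N-1}` is idempotent (`N ≤ L`). [folklore] -/
theorem bigBlock_mul_self (L : ℕ) [NeZero L] {N : ℕ} (hN : N ≤ L) (x : ZMod L) (A : MPSTensor q D) :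
    localOp (ringBlock L N x) (onRingBlock L N x (parentLocalTerm N A)) *
      localOp (ringBlock L N x) (onRingBlock L N x (parentLocalTerm N A)) =
      localOp (ringBlock L N x) (onRingBlock L N x (parentLocalTerm N A)) := by
  rw [onRingBlock, ← localOp_submatrix_mul _ (ringBlockSite_bijective L N hN x), parentLocalTerm,
    projMatrix_mul_self]

/-- The big-block operator `(h_N)_{x,…,x+N-1}` is positive semidefinite. [folklore] -/
theorem posSemidef_bigBlock (L : ℕ) [NeZero L] (N : ℕ) (x : ZMod L) (A : MPSTensor q D) :
    (localOp (ringBlock L N x) (onRingBlock L N x (parentLocalTerm N A))).PosSemidef :=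
  posSemidef_localOp _ (posSemidef_onRingBlock L N x (parentLocalTerm_posSemidef N A))

/-- Big-block operators on disjoint ring blocks commute. [folklore] -/
theorem bigBlock_commute (L : ℕ) [NeZero L] {N N' : ℕ} {x x' : ZMod L}
    (h : Disjoint (ringBlock L N x) (ringBlock L N' x')) (A : MPSTensor q D) :
    localOp (ringBlock L N x) (onRingBlock L N x (parentLocalTerm N A)) *
      localOp (ringBlock L N' x') (onRingBlock L N' x' (parentLocalTerm N' A)) =
      localOp (ringBlock L N' x') (onRingBlock L N' x' (parentLocalTerm N' A)) *
        localOp (ringBlock L N x) (onRingBlock L N x (parentLocalTerm N A)) :=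
  (commute_of_disjoint_holds (isSupportedOn_localOp _ _) (isSupportedOn_localOp _ _) h).eq

/-! ### The cross term of two neighbouring big blocks on the ring -/

/-- **The cross term of two neighbouring big blocks on the ring** (transport of
`posSemidef_pair_chain`): for three consecutive segments of lengths `a, b, c` starting at `x`
(`a + b + c ≤ L`, `b > 0`), the big-block projections `E₁ = (h_{a+b})_{x,…}` and
`E₂ = (h_{b+c})_{x+a,…}` satisfy `E₁ E₂ + E₂ E₁ + ε' (E₁ + E₂) ≥ 0` under the hypotheses of
`posSemidef_pair_chain`. Fannes–Nachtergaele–Werner (1992), proof of Thm. 6.4 (the cross terms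
`|i - j| = 1`). [cite: FannesNachtergaeleWernerCMP1992, Thm. 6.4] -/
theorem posSemidef_pair_ring (A : MPSTensor q D) {ρ : Matrix (Fin D) (Fin D) ℂ}
    (h1 : transferOp A 1 = 1) (hρ : transferOp (fun i => (A i)ᴴ) ρ = ρ)
    (hρ1 : (1 - ρ).PosSemidef) {lam : ℝ} (hlam : 0 < lam)
    (hlamρ : (ρ - (lam : ℂ) • (1 : Matrix (Fin D) (Fin D) ℂ)).PosSemidef)
    {a b c : ℕ} (hb : 0 < b) (L : ℕ) [NeZero L] (hL : a + b + c ≤ L) (x : ZMod L)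
    {δ ε ε' : ℝ} (hδ0 : 0 ≤ δ) (hδlam : δ * (D : ℝ) ^ 2 ≤ lam / 2)
    (hδb : ∀ a' d' i j : Fin D, ‖((transferOp A ^ b) (Matrix.single a' d' 1) -
      ρ d' a' • (1 : Matrix (Fin D) (Fin D) ℂ)) i j‖ ≤ δ)
    (hδab : ∀ a' d' i j : Fin D, ‖((transferOp A ^ (a + b)) (Matrix.single a' d' 1) -
      ρ d' a' • (1 : Matrix (Fin D) (Fin D) ℂ)) i j‖ ≤ δ)
    (hδbc : ∀ a' d' i j : Fin D, ‖((transferOp A ^ (b + c)) (Matrix.single a' d' 1) -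
      ρ d' a' • (1 : Matrix (Fin D) (Fin D) ℂ)) i j‖ ≤ δ)
    (hε : 2 / lam * (δ * (D : ℝ) ^ 2 * Real.sqrt lam⁻¹ +
        (δ * (D : ℝ) ^ 2) ^ 2 * lam⁻¹ ^ 2 * Real.sqrt lam⁻¹) ≤ ε)
    (hε'0 : 0 ≤ ε') (hrel : ε' * (1 - ε) = ε) :
    (localOp (ringBlock L (a + b) x) (onRingBlock L (a + b) x (parentLocalTerm (a + b) A)) *
        localOp (ringBlock L (b + c) (x + ((a : ℕ) : ZMod L)))
          (onRingBlock L (b + c) (x + ((a : ℕ) : ZMod L)) (parentLocalTerm (b + c) A)) +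
      localOp (ringBlock L (b + c) (x + ((a : ℕ) : ZMod L)))
          (onRingBlock L (b + c) (x + ((a : ℕ) : ZMod L)) (parentLocalTerm (b + c) A)) *
        localOp (ringBlock L (a + b) x) (onRingBlock L (a + b) x (parentLocalTerm (a + b) A)) +
      ((ε' : ℝ) : ℂ) •
        (localOp (ringBlock L (a + b) x) (onRingBlock L (a + b) x (parentLocalTerm (a + b) A)) +
          localOp (ringBlock L (b + c) (x + ((a : ℕ) : ZMod L)))
            (onRingBlock L (b + c) (x + ((a : ℕ) : ZMod L)) (parentLocalTerm (b + c) A)))).PosSemidef := by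
  set x₀ : Fin (a + b + c) := ⟨0, by omega⟩ with hx₀
  set x₁ : Fin (a + b + c) := ⟨a, by omega⟩ with hx₁
  have h₀ : (x₀ : ℕ) + (a + b) ≤ a + b + c := by simp [hx₀]
  have h₁ : (x₁ : ℕ) + (b + c) ≤ a + b + c := by simp [hx₁]; omega
  have hchain := posSemidef_pair_chain A h1 hρ hρ1 hlam hlamρ x₀ rfl h₀ x₁ rfl h₁ hδ0 hδlam hδb
    hδab hδbc hε hε'0 hrel
  have hring := posSemidef_localOp (ringBlock L (a + b + c) x)
    (posSemidef_onRingBlock L (a + b + c) x hchain)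
  have hg := ringBlockSite_bijective L (a + b + c) hL x
  simp only [onRingBlock, localOp_submatrix_add, localOp_submatrix_smul, localOp_submatrix_mul _ hg]
    at hring
  have e₀ := localOp_ringBlock_onRingBlock_localOp_chainBlock L hL x x₀ h₀ (parentLocalTerm (a + b) A)
  have e₁ := localOp_ringBlock_onRingBlock_localOp_chainBlock L hL x x₁ h₁ (parentLocalTerm (b + c) A)
  simp only [onRingBlock] at e₀ e₁
  rw [e₀, e₁] at hring
  have hx₀' : x + (((x₀ : ℕ) : ℕ) : ZMod L) = x := by simp [hx₀]
  have hx₁' : (((x₁ : ℕ) : ℕ) : ZMod L) = ((a : ℕ) : ZMod L) := by simp [hx₁]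
  rw [hx₀', hx₁'] at hring
  exact hring

end QLattice

end Literature.MathematicalPhysics.QuantumLattice
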